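import Summits.CriticalPhenomena.PercolationContinuityZ3.Theorems.PercNearOneGluingNoHeavyLowerTailOneCutCertAlgebra
import Summits.CriticalPhenomena.PercolationContinuityZ3.Theorems.PercNearOneGluingHalfWeightReduction
import Summits.CriticalPhenomena.PercolationContinuityZ3.Theorems.AdditiveGluing.Negative.CertSoundness
import Literature.Probability.Percolation.ProdBernoulliRusso

/-!
# `NoHeavyLowerTail` (crux stmt-CriticalPhenomena-4575), certificate programme for the one-cut bound at
# `|A| = 5`: percolation probabilities as multilinear polynomials in the edge weights

Layer 3 of the kernel-checked certificate checker (prim-cert-2).  On the vertex set `Fin n` with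
ARBITRARY weights `w : Sym2 (Fin n) → [0,1]`, every event `B` determined by the non-diagonal pairs has

  `P_w(B) = ML (evT B) (xOf w)`   (`real_eq_ML`),

where the coordinates are the `m = |allPairs n|` pairs `i < j` (`edge n i`), `xOf w i = w (edge i)`, and
the corner table `evT B g ∈ {0,1}` is the indicator that the deterministic configuration `cfg g`
(the pairs `i` with `g i = true`) lies in `B` — Russo's cylinder formula
(`RussoPath.prodBernoulli_real_eq_sum_powerset`) re-indexed by corners.  The events of the one-cut
bound (`{a ↮ b}`, `{1 ≤ N ≤ 2}`, `E N = Σ_a P(o ↔ a)`) get their tables, together with computable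
`Bool`/`ℕ` versions read off the reach table of `cfg g` (`AdditiveGluing.Negative.CertChecker`).

Nothing here asserts anything about the crux.
-/

namespace Summit.CriticalPhenomena.PercolationContinuityZ3.Theorems.OneCutCert

open Finset MeasureTheory
open scoped BigOperators Classical
open Literature.Probability.Percolation Literature.Probability.LatticeModels
open Summit.CriticalPhenomena.PercolationContinuityZ3.Theorems.AdditiveGluing.Negative.Cert

variable {n : ℕ}

/-! ## Coordinates = the pairs `i < j` -/

/-- Number of coordinates: the pairs `i < j < n`. [this work] -/
abbrev mE (n : ℕ) : ℕ := (allPairs n).length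

/-- The `i`-th coordinate pair. [this work] -/
def edge (n : ℕ) (i : Fin (mE n)) : Fin n × Fin n := (allPairs n)[i]

/-- The `i`-th coordinate as an unordered pair. [this work] -/
def edgeE (n : ℕ) (i : Fin (mE n)) : Sym2 (Fin n) := mkE (edge n i)

/-- `edgeE` is injective. [this work] -/
theorem edgeE_injective (n : ℕ) : Function.Injective (edgeE n) := by
  intro i j h
  have hnd : ((allPairs n).map mkE).Nodup := nodup_map_mk_of_sublist (List.Sublist.refl _)
  unfold edgeE edge at h
  have h' : ((allPairs n).map mkE)[i.1]'(by simp) = ((allPairs n).map mkE)[j.1]'(by simp) := by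
    simpa [List.getElem_map] using h
  exact Fin.ext ((hnd.getElem_inj_iff).1 h')

/-- The coordinate pairs are exactly the non-diagonal unordered pairs. [this work] -/
theorem mem_range_edgeE (e : Sym2 (Fin n)) : e ∈ Set.range (edgeE n) ↔ ¬ e.IsDiag := by
  induction e using Sym2.ind with
  | _ x y =>
    rw [Sym2.mk_isDiag_iff]
    constructor
    · rintro ⟨i, hi⟩
      have hmem : edge n i ∈ allPairs n := List.getElem_mem _
      have hlt := (mem_allPairs _).1 hmem
      unfold edgeE at hi
      rcases (mkE_eq_iff (edge n i) x y).1 hi with h | h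
      · rw [h] at hlt; exact ne_of_lt hlt
      · rw [h] at hlt; exact (ne_of_lt hlt).symm
    · intro hxy
      rcases lt_or_gt_of_ne hxy with h | h
      · obtain ⟨i, hi, heq⟩ := List.getElem_of_mem ((mem_allPairs (x, y)).2 h)
        refine ⟨⟨i, hi⟩, ?_⟩
        unfold edgeE edge
        simp only [Fin.getElem_fin, heq]
        rfl
      · obtain ⟨i, hi, heq⟩ := List.getElem_of_mem ((mem_allPairs (y, x)).2 h)
        refine ⟨⟨i, hi⟩, ?_⟩
        unfold edgeE edge
        simp only [Fin.getElem_fin, heq]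
        exact Sym2.eq_swap

/-- The finset of coordinate pairs. [this work] -/
def KE (n : ℕ) : Finset (Sym2 (Fin n)) := Finset.univ.image (edgeE n)

/-- The coordinate pairs as a set: the non-diagonal pairs. [this work] -/
theorem coe_KE (n : ℕ) : (↑(KE n) : Set (Sym2 (Fin n))) = {e | ¬ e.IsDiag} := by
  ext e
  rw [KE, Finset.coe_image, Finset.coe_univ, Set.image_univ, Set.mem_setOf_eq]
  exact mem_range_edgeE e

/-! ## Corners as configurations -/

/-- The deterministic configuration of a corner: the list of open coordinate pairs. [this work] -/
def cfg (g : Fin (mE n) → Bool) : List (Fin n × Fin n) :=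
  ((List.finRange (mE n)).filter fun i => g i).map (edge n)

/-- The edge set of `cfg g` is `{edgeE i : g i}`. [this work] -/
theorem mem_Eset_cfg (g : Fin (mE n) → Bool) (e : Sym2 (Fin n)) :
    e ∈ Eset (cfg g) ↔ ∃ i, g i = true ∧ edgeE n i = e := by
  unfold cfg Eset
  simp only [List.map_map, List.mem_toFinset, List.mem_map, List.mem_filter, List.mem_finRange,
    true_and, Function.comp]
  rfl

/-- The edge set of `cfg g` as an image. [this work] -/
theorem Eset_cfg_eq (g : Fin (mE n) → Bool) :
    Eset (cfg g) = (Finset.univ.filter fun i => g i = true).image (edgeE n) := by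
  ext e
  rw [mem_Eset_cfg, Finset.mem_image]
  simp only [Finset.mem_filter, Finset.mem_univ, true_and]

/-- The point of the cube attached to the weights: `x_i = w (edge i)`. [this work] -/
def xOf (w : Sym2 (Fin n) → unitInterval) : Fin (mE n) → ℝ := fun i => (w (edgeE n i) : ℝ)

/-- `xOf w` lies in the unit cube. [this work] -/
theorem inCube_xOf (w : Sym2 (Fin n) → unitInterval) : InCube (xOf w) :=
  fun i => ⟨(w (edgeE n i)).2.1, (w (edgeE n i)).2.2⟩

open Classical in
/-- The corner table of an event: indicator of `cfg g ∈ B`. [this work] -/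
noncomputable def evT (B : Set (Set (Sym2 (Fin n)))) (g : Fin (mE n) → Bool) : ℝ :=
  if (↑(Eset (cfg g)) : Set (Sym2 (Fin n))) ∈ B then 1 else 0

/-- An event of the open graph is determined by the coordinate pairs. [this work] -/
theorem determinedBy_KE_of_openGraph (B : Set (Set (Sym2 (Fin n))))
    (hB : ∀ ω ω' : Set (Sym2 (Fin n)), openGraph ω = openGraph ω' → (ω ∈ B ↔ ω' ∈ B)) :
    DeterminedBy B (↑(KE n) : Set (Sym2 (Fin n))) := by
  rw [coe_KE, determinedBy_iff]
  intro ω ω' h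
  exact hB ω ω' (openGraph_eq_of_inter_eq h)

/-- Membership of a coordinate pair in `Eset (cfg g)`. [this work] -/
theorem edgeE_mem_Eset_cfg (g : Fin (mE n) → Bool) (i : Fin (mE n)) :
    edgeE n i ∈ Eset (cfg g) ↔ g i = true := by
  rw [mem_Eset_cfg]
  constructor
  · rintro ⟨j, hj, hji⟩
    rw [← edgeE_injective n hji]; exact hj
  · intro h; exact ⟨i, h, rfl⟩

open Classical in
/-- **Russo's cylinder formula, corner-indexed: `P_w(B) = ML (evT B) (xOf w)`** for every event of
the open graph. [folklore] -/
theorem real_eq_ML (w : Sym2 (Fin n) → unitInterval) (B : Set (Set (Sym2 (Fin n))))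
    (hB : ∀ ω ω' : Set (Sym2 (Fin n)), openGraph ω = openGraph ω' → (ω ∈ B ↔ ω' ∈ B)) :
    (prodBernoulli w).real B = ML (evT B) (xOf w) := by
  rw [RussoPath.prodBernoulli_real_eq_sum_powerset (determinedBy_KE_of_openGraph B hB) w]
  unfold ML
  symm
  refine Finset.sum_nbij' (fun g => Eset (cfg g)) (fun S i => decide (edgeE n i ∈ S)) ?_ ?_ ?_ ?_ ?_
  · intro g _
    rw [Finset.mem_powerset, Eset_cfg_eq]
    exact Finset.image_subset_image (Finset.filter_subset _ _)
  · intro S _; exact Finset.mem_univ _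
  · intro g _
    funext i
    by_cases h : g i = true
    · rw [h, decide_eq_true_iff]; exact (edgeE_mem_Eset_cfg g i).2 h
    · rw [Bool.not_eq_true] at h
      rw [h, decide_eq_false_iff_not, edgeE_mem_Eset_cfg, h]; exact Bool.false_ne_true
  · intro S hS
    rw [Finset.mem_powerset] at hS
    ext e
    rw [mem_Eset_cfg]
    constructor
    · rintro ⟨i, hi, rfl⟩; exact of_decide_eq_true hi
    · intro he
      obtain ⟨i, _, rfl⟩ := Finset.mem_image.1 (hS he)
      exact ⟨i, decide_eq_true he, rfl⟩
  · intro g _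
    unfold evT mono xOf
    split_ifs with hmem
    · rw [one_mul, KE, Finset.prod_image fun i _ j _ h => edgeE_injective n h]
      refine Finset.prod_congr rfl fun i _ => ?_
      by_cases h : g i = true
      · rw [if_pos h, if_pos ((edgeE_mem_Eset_cfg g i).2 h)]
      · rw [if_neg h, if_neg (fun h' => h ((edgeE_mem_Eset_cfg g i).1 h'))]
    · rw [zero_mul]

/-- `ML` commutes with finite sums of tables. [folklore] -/
theorem ML_finset_sum {ι : Type*} (s : Finset ι) (T : ι → (Fin (mE n) → Bool) → ℝ) (x : Fin (mE n) → ℝ) :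
    ML (fun g => ∑ a ∈ s, T a g) x = ∑ a ∈ s, ML (T a) x := by
  unfold ML
  rw [Finset.sum_comm]
  exact Finset.sum_congr rfl fun g _ => by rw [Finset.sum_mul]

/-! ## The events of the one-cut bound and their computable corner functions -/

/-- Connection in the configuration of a corner, read off the reach table. [this work] -/
def connB (g : Fin (mE n) → Bool) (a b : Fin n) : Bool := ((reachTable n (cfg g)).getD a 0).testBit b

/-- `connB` decides `{a ↔ b}` at the corner. [this work] -/
theorem connB_iff (g : Fin (mE n) → Bool) (a b : Fin n) :
    connB g a b = true ↔ (↑(Eset (cfg g)) : Set (Sym2 (Fin n))) ∈ openConn a b :=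
  testBit_reachTable_iff_mem_openConn (cfg g) a b

/-- Number of relays joined to `o` at the corner. [this work] -/
def Ncount (g : Fin (mE n) → Bool) (o : Fin n) (A : Finset (Fin n)) : ℕ :=
  (A.filter fun a => connB g o a = true).card

/-- `Ncount` is the relay count of the corner configuration. [this work] -/
theorem Ncount_eq (g : Fin (mE n) → Bool) (o : Fin n) (A : Finset (Fin n)) :
    Ncount g o A = (A.filter fun a => (↑(Eset (cfg g)) : Set (Sym2 (Fin n))) ∈ openConn o a).card := by
  unfold Ncount
  congr 1
  exact Finset.filter_congr fun a _ => connB_iff g o a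

/-- `{a ↔ b}` is an event of the open graph. [folklore] -/
theorem openConn_of_openGraph (a b : Fin n) (ω ω' : Set (Sym2 (Fin n))) (h : openGraph ω = openGraph ω') :
    ω ∈ openConn a b ↔ ω' ∈ openConn a b := by
  show (openGraph ω).Reachable a b ↔ (openGraph ω').Reachable a b
  rw [h]

/-- **Table of a cut**: `P_w(a ↮ b) = ML (1 − connB · a b) (xOf w)`. [this work] -/
theorem real_sep_eq_ML (w : Sym2 (Fin n) → unitInterval) (a b : Fin n) :
    (prodBernoulli w).real (openConn a b)ᶜ = ML (fun g => if connB g a b then 0 else 1) (xOf w) := by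
  classical
  rw [real_eq_ML w (openConn a b)ᶜ fun ω ω' h => not_congr (openConn_of_openGraph a b ω ω' h)]
  congr 1
  funext g
  unfold evT
  rw [Set.mem_compl_iff, ← connB_iff]
  cases connB g a b <;> simp

/-- **Table of the low count event**: `P_w(1 ≤ N ≤ 2) = ML 1[1 ≤ Ncount ≤ 2] (xOf w)`. [this work] -/
theorem real_low_eq_ML (w : Sym2 (Fin n) → unitInterval) (o : Fin n) (A : Finset (Fin n)) :
    (prodBernoulli w).real {ω : BondConfig (Fin n) |
        1 ≤ (A.filter fun a => ω ∈ openConn o a).card ∧ (A.filter fun a => ω ∈ openConn o a).card ≤ 2}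
      = ML (fun g => if 1 ≤ Ncount g o A ∧ Ncount g o A ≤ 2 then 1 else 0) (xOf w) := by
  classical
  have hB : ∀ ω ω' : Set (Sym2 (Fin n)), openGraph ω = openGraph ω' →
      (ω ∈ {ω : BondConfig (Fin n) | 1 ≤ (A.filter fun a => ω ∈ openConn o a).card ∧
          (A.filter fun a => ω ∈ openConn o a).card ≤ 2} ↔
       ω' ∈ {ω : BondConfig (Fin n) | 1 ≤ (A.filter fun a => ω ∈ openConn o a).card ∧
          (A.filter fun a => ω ∈ openConn o a).card ≤ 2}) := by
    intro ω ω' h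
    have : (A.filter fun a => ω ∈ openConn o a) = A.filter fun a => ω' ∈ openConn o a :=
      Finset.filter_congr fun a _ => openConn_of_openGraph o a ω ω' h
    simp only [Set.mem_setOf_eq, this]
  rw [real_eq_ML w _ hB]
  congr 1
  funext g
  unfold evT
  rw [Set.mem_setOf_eq, ← Ncount_eq]
  split_ifs <;> rfl

/-- **Table of the mean count**: `E N = Σ_{a∈A} P_w(o ↔ a) = ML (Ncount · o A) (xOf w)`. [this work] -/
theorem meanCount_eq_ML (w : Sym2 (Fin n) → unitInterval) (o : Fin n) (A : Finset (Fin n)) :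
    ∑ a ∈ A, (prodBernoulli w).real (openConn o a) = ML (fun g => (Ncount g o A : ℝ)) (xOf w) := by
  classical
  have h1 : ∀ a ∈ A, (prodBernoulli w).real (openConn o a) =
      ML (fun g => if connB g o a then 1 else 0) (xOf w) := by
    intro a _
    rw [real_eq_ML w (openConn o a) (openConn_of_openGraph o a)]
    congr 1; funext g; unfold evT
    rw [← connB_iff]
    cases connB g o a <;> simp
  rw [Finset.sum_congr rfl h1, ← ML_finset_sum]
  congr 1
  funext g
  unfold Ncount
  rw [Finset.card_filter]
  push_cast
  exact Finset.sum_congr rfl fun a _ => by cases connB g o a <;> simp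

/-! ## Box patterns per coordinate and relay pairs (shared by the checker and the assembly) -/

/-- Lower end of the range of a coordinate with pattern `d` (`0`: `[0,1]`, `1`: `[0,½]`, `2`: `[½,1]`). [this work] -/
noncomputable def loOf (d : Fin 3) : ℝ := if d.val = 2 then 1 / 2 else 0

/-- Upper end of the range of a coordinate with pattern `d`. [this work] -/
noncomputable def hiOf (d : Fin 3) : ℝ := if d.val = 1 then 1 / 2 else 1

/-- The ranges are nondegenerate. [this work] -/
theorem loOf_lt_hiOf (d : Fin 3) : loOf d < hiOf d := by
  unfold loOf hiOf; fin_cases d <;> norm_num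

/-- All pairs `a < b` of a vertex list (as `Fin n` pairs), in list order. [this work] -/
def relPairs {n : ℕ} : List (Fin n) → List (Fin n × Fin n)
  | [] => []
  | a :: l => (l.map fun b => (a, b)) ++ relPairs l


end Summit.CriticalPhenomena.PercolationContinuityZ3.Theorems.OneCutCert
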